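import Summits.Ventures.HSemireg.WedgeHankelTwoNodesShear
import Summits.Ventures.HSemireg.WedgeHankelScale
import Summits.Ventures.HSemireg.WedgeHankelTwoNodesRank

/-!
# Venture HSemireg — THE TWO-NODE CONFLUENT KERNEL LAW AT TWO FINITE NODES `λ ≠ μ`: the class `exp(λΘ)·p(Θ) + exp(μΘ)·p′(Θ)`
# (`deg p = P`, `deg p′ = P′`) has kernel `SI_k ⊔ Gs λ μ (xyRich(k, P, P′))` for `k ≤ n − P − P′ − 1` — E8 transported by the TWO-FRAME automorphism

HONEST FRAMING. Part of the Lean index of the computation cell `pub-hsemireg` (seat p10 gen 16, Sunday typer «UNIFORM-IN-n»).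
Finite-dimensional EXTERIOR ALGEBRA over a field ONLY: no variety, no cohomology theory, no sheaf, no Ext group, no semiregularity map;
nothing here says that HC / HC_CM / HC_AV holds; no Literature fact is declared or used.  Custodian versions as in `WedgeHankelSiegelIdeal` (1/3),
`WedgeHankelFrameChange`, `WedgeHankelTwoNodes`; the dictionary (`exp(λΘ)·v` ↦ `expMul λ q`; the frame `u^λ_a = x_a + λ y_a` of the node `λ`) is QUOTED,
never asserted.

WHAT IS IN THE TREE.  E8 `Kr_w_eq_of_two_orders` (nodes `0`, `∞`), E9 `Kr_w_expMul_add_top` (nodes `λ`, `∞`); E5's frame change `Φs λ` (`x_a ↦ x_a + λ y_a`,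
classes `q ↦ expMul λ q`), E7's swap `Ψs` (`x_a ↔ y_a`, classes `q ↦ rev_n q`), E12's scaling `Δs μ` (`y_a ↦ μ y_a`, classes `q ↦ (μ^j q_j)`).  E9's header
names the obstacle to two FINITE nodes: an automorphism moving `∞` to a finite node passes a finite node of higher order through the inversion, whose
action on the coefficient SEQUENCE is a binomial identity (reversal ∘ binomial transform on polynomial sequences).  THIS FILE removes the obstacle
WITHOUT that identity: the needed sequence statement is read off an identity of AUTOMORPHISMS, checked on the generators.
* §45 the LOWER SHEAR **`Ls c := Ψs ∘ Φs c ∘ Ψs`** (`x_a ↦ x_a`, `y_a ↦ y_a + c x_a`; node `0` fixed, `∞ ↦ 1/c`): `Ls_w`: `Ls c (w_n(q)) = w_n(lowMul c q)`,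
  `lowMul c q := rev_n (expMul c (rev_n q))`; it preserves «supported on `[0, P]` with the same `P`-th entry» (`lowMul_apply_eq_zero`, `lowMul_apply_self`)
  — a node at `0` keeps its order; `Ls (−c)` inverts `Ls c`; the Siegel ideal is fixed.
* §46 `algHom_ext_XY` (two algebra maps agreeing on every `x_a`, `y_a` are equal) and **THE BRUHAT-TYPE IDENTITY `Ls_neg_Φs`:
  `Ls (−d⁻¹) ∘ Φs d = Δs d ∘ Ψs ∘ Δs (−d⁻¹) ∘ Ls d⁻¹`** (`d ≠ 0`; the `2 × 2` identity `[[1,−c],[0,1]]·[[1,0],[d,1]] = [[0,−c],[d,1]]`, `cd = 1`, on every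
  pair `(x_a, y_a)`).  Its left side moves the node `d` to `∞`; its right side is elementary on node-`0` classes, so **`Ls_neg_Φs_w`**: `Ls (−d⁻¹) (Φs d (w_n q))
  = w_n(scaleSeq d (rev_n (scaleSeq (−d⁻¹) (lowMul d⁻¹ q))))` — for `q` supported on `[0, P′]` a TOP WINDOW of order `P′ + 1` with explicit non-zero entry.
* §47 **THE TWO-FRAME AUTOMORPHISM `Gs λ μ := Φs λ ∘ Ls (μ−λ)⁻¹`**: `Gs_X`: `x_a ↦ x_a + λ y_a = u^λ_a`, `Gs_Y`: `y_a ↦ (μ−λ)⁻¹ (x_a + μ y_a) ∝ u^μ_a` (`λ ≠ μ`);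
  kernels transported (`Kr_Gs`), Siegel ideal fixed (`map_Gs_siegelIdeal`); nodes `0 ↦ λ`, `∞ ↦ μ`.
* §48 **THE LAW `Kr_w_two_finite_nodes`: for `λ ≠ μ`, `q₁` supported on `[0, P]` with `q₁ P ≠ 0`, `q₂` supported on `[0, P′]` with `q₂ P′ ≠ 0` and
  `k + P + P′ + 1 ≤ n`: `Kr(univ, w_n(expMul λ q₁ + expMul μ q₂), k) = SI_k ⊔ Gs λ μ (xyRich(k, P, P′))`** — the Siegel ideal plus the forms with more than
  `P` letters from the frame `{u^λ_a}` and more than `P′` letters from the frame `{u^μ_a}`; it depends only on `(λ, μ, P, P′)` (`Kr_w_two_finite_nodes_eq`);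
  `P = P′ = 0` (two pure classes `A λ^• + B μ^•`): `Kr = Gs λ μ (xyRich(k, 0, 0))` EXACTLY (`Kr_w_exp_add_exp`) — gen 14's `F_λ(k) ∩ F_μ(k)` by value;
  THE RANK: **`rank_hankel1_two_finite_nodes`: `rank H_k(expMul λ q₁ + expMul μ q₂) = min(k+1, P+P′+2)`** (THEOREM H; no matrix computation).
NOT typed here: three or more nodes (the divisor `Σ_i (P_i+1)[λ_i]`; needs a rank statement for confluent Vandermonde systems or an induction over
nodes); the degrees `k ≥ n − P − P′`; the literal bridge `Gs λ μ (xyRich(k,0,0)) = F_λ(k) ⊓ F_μ(k)` with gen 13/14's `frameIdeal` (a file importing D2).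
Class side only.  Namespace `Summit.Ventures.HSemireg.Wedge.HankelFrameChange` (continued); new names only.
-/

open Module

namespace Summit.Ventures.HSemireg.Wedge.HankelFrameChange

open Summit.Ventures.HSemireg.Wedge Summit.Ventures.HSemireg.Wedge.Kunneth Summit.Ventures.HSemireg.Wedge.Hankel
  Summit.Ventures.HSemireg.Wedge.BasisFree Summit.Ventures.HSemireg.Wedge.HankelSiegel Summit.Ventures.HSemireg.Wedge.HankelSiegelIdeal
  Summit.Ventures.HSemireg.Wedge.KunnethKernel

variable (K : Type*) [Field K] {n : ℕ}

/-! ## §45. The lower shear `y_a ↦ y_a + c x_a` -/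

/-- **THE LOWER SHEAR `Ls c := Ψs ∘ Φs c ∘ Ψs`** — E5's frame change conjugated by E7's swap. -/
noncomputable def Ls (c : K) : HT K (In n) ≃ₐ[K] HT K (In n) := ((Ψs K (n := n)).trans (Φs K c)).trans (Ψs K)

/-- `Ls c f = Ψs (Φs c (Ψs f))`. -/
lemma Ls_apply (c : K) (f : HT K (In n)) : Ls K c f = Ψs K (Φs K c (Ψs K f)) := rfl

/-- **`Ls c (x_a) = x_a`.** -/
theorem Ls_X (c : K) (a : Fin n) : Ls K (n := n) c (X K n a) = X K n a := by
  rw [Ls_apply, Ψs_X, Φs_Y, Ψs_Y]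

/-- **`Ls c (y_a) = y_a + c x_a`.** -/
theorem Ls_Y (c : K) (a : Fin n) : Ls K (n := n) c (Y K n a) = Y K n a + c • X K n a := by
  rw [Ls_apply, Ψs_Y, Φs_X, map_add, map_smul, Ψs_X, Ψs_Y]

/-- the coefficient action of the lower shear: **`lowMul c q := rev_n (expMul c (rev_n q))`**; on `[0, n]`,
`(lowMul c q)_j = Σ_{m = j}^{n} C(n−j, m−j) c^{m−j} q_m` (not needed below). -/
def lowMul (n : ℕ) (c : K) (q : ℕ → K) : ℕ → K := rev K n (expMul K c (rev K n q))

/-- **`Ls c (w_n(q)) = w_n(lowMul c q)`** (E7's `Ψs_w`, E5's `Φs_w`). -/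
theorem Ls_w (c : K) (q : ℕ → K) : Ls K (n := n) c (w K n n q) = w K n n (lowMul K n c q) := by
  rw [Ls_apply, Ψs_w K le_rfl, Φs_w K c le_rfl, Ψs_w K le_rfl]; rfl

/-- the reversal of a sequence supported on `[0, P]` vanishes below `n − P`. -/
lemma rev_apply_eq_zero_of_lt_sub {P : ℕ} {r : ℕ → K} (hr : ∀ j, P < j → r j = 0) {i : ℕ} (hi : i < n - P) : rev K n r i = 0 := by
  rw [rev_apply_of_le K (show i ≤ n by omega)]; exact hr _ (by omega)

/-- … and its entry at `n − P` is `r_P` (`P ≤ n`). -/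
lemma rev_apply_sub {P : ℕ} (hP : P ≤ n) (r : ℕ → K) : rev K n r (n - P) = r P := by
  rw [rev_apply_of_le K (Nat.sub_le n P)]; congr 1; omega

/-- **A NODE AT `0` KEEPS ITS ORDER under the lower shear, (i)**: `lowMul c r` vanishes beyond `P` if `r` does. -/
theorem lowMul_apply_eq_zero (c : K) {P : ℕ} {r : ℕ → K} (hr : ∀ j, P < j → r j = 0) {j : ℕ} (hj : P < j) : lowMul K n c r j = 0 := by
  unfold lowMul
  by_cases hjn : j ≤ n
  · rw [rev_apply_of_le K hjn]
    exact expMul_apply_eq_zero_of_lt K c (fun i hi => rev_apply_eq_zero_of_lt_sub K hr hi) (by omega)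
  · exact rev_apply_of_lt K (by omega) _

/-- **(ii)**: `(lowMul c r)_P = r_P` if `r` vanishes beyond `P ≤ n`. -/
theorem lowMul_apply_self (c : K) {P : ℕ} (hP : P ≤ n) {r : ℕ → K} (hr : ∀ j, P < j → r j = 0) : lowMul K n c r P = r P := by
  unfold lowMul
  rw [rev_apply_of_le K hP, expMul_apply_of_vanish_below K c (fun i hi => rev_apply_eq_zero_of_lt_sub K hr hi), rev_apply_sub K hP]

/-- `lowMul` is additive. -/
lemma lowMul_add (c : K) (q q' : ℕ → K) (j : ℕ) : lowMul K n c (fun i => q i + q' i) j = lowMul K n c q j + lowMul K n c q' j := by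
  unfold lowMul
  have e1 : rev K n (fun i => q i + q' i) = fun i => rev K n q i + rev K n q' i := by
    funext i; unfold rev; split_ifs <;> simp
  have e2 : expMul K c (fun i => rev K n q i + rev K n q' i) = fun i => expMul K c (rev K n q) i + expMul K c (rev K n q') i :=
    funext (expMul_add K c _ _)
  rw [e1, e2]; unfold rev; split_ifs <;> simp

/-! ## §46. Generator-level extensionality and the Bruhat-type identity -/

/-- **two algebra maps out of `⋀(K^{2n})` agreeing on every `x_a` and every `y_a` are equal** (`ExteriorAlgebra.hom_ext` on the standard basis). -/
theorem algHom_ext_XY {A : Type*} [Ring A] [Algebra K A] {f g : HT K (In n) →ₐ[K] A} (hX : ∀ a : Fin n, f (X K n a) = g (X K n a))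
    (hY : ∀ a : Fin n, f (Y K n a) = g (Y K n a)) : f = g := by
  apply ExteriorAlgebra.hom_ext
  refine (b K (In n)).ext fun i => ?_
  rw [LinearMap.comp_apply, LinearMap.comp_apply, AlgHom.toLinearMap_apply, AlgHom.toLinearMap_apply]
  rcases lt_or_ge (i : ℕ) n with hi | hi
  · have e : i = Fin.castAdd n ⟨i, hi⟩ := Fin.ext rfl
    rw [e, ← X_fin]; exact hX _
  · have e : i = Fin.natAdd n ⟨i - n, by have := i.2; omega⟩ := Fin.ext (by simp [Fin.natAdd]; omega)
    rw [e, ← Y_fin]; exact hY _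

/-- the same for algebra automorphisms of the model. -/
theorem algEquiv_ext_XY {f g : HT K (In n) ≃ₐ[K] HT K (In n)} (hX : ∀ a : Fin n, f (X K n a) = g (X K n a))
    (hY : ∀ a : Fin n, f (Y K n a) = g (Y K n a)) : f = g := by
  have h : (f : HT K (In n) →ₐ[K] HT K (In n)) = (g : HT K (In n) →ₐ[K] HT K (In n)) :=
    algHom_ext_XY K (fun a => by simpa using hX a) (fun a => by simpa using hY a)
  exact AlgEquiv.ext fun x => AlgHom.congr_fun h x

/-- `Ls (−c)` undoes `Ls c`. -/
theorem Ls_neg_Ls (c : K) (f : HT K (In n)) : Ls K (-c) (Ls K c f) = f := by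
  have h : (Ls K (n := n) c).trans (Ls K (-c)) = AlgEquiv.refl :=
    algEquiv_ext_XY K (fun a => by rw [AlgEquiv.trans_apply, Ls_X, Ls_X]; rfl)
      (fun a => by
        rw [AlgEquiv.trans_apply, Ls_Y, map_add, map_smul, Ls_Y, Ls_X, AlgEquiv.coe_refl, id, neg_smul]
        abel)
  exact AlgEquiv.congr_fun h f

/-- `Ls c` undoes `Ls (−c)`. -/
theorem Ls_Ls_neg (c : K) (f : HT K (In n)) : Ls K c (Ls K (-c) f) = f := by
  have := Ls_neg_Ls K (-c) f; rwa [neg_neg] at this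

/-- **THE BRUHAT-TYPE IDENTITY `Ls (−d⁻¹) ∘ Φs d = Δs d ∘ Ψs ∘ Δs (−d⁻¹) ∘ Ls d⁻¹`** (`d ≠ 0`): the left side moves the node `d` to `∞`
(`0 ↦ d ↦ ∞` under `Φs d` then `Ls (−d⁻¹)`), the right side is «elementary maps fixing the node `0`, then the swap, then a scaling».
Checked on the generators: both send `x_a ↦ d y_a` and `y_a ↦ y_a − d⁻¹ x_a`. -/
theorem Ls_neg_Φs {d : K} (hd : d ≠ 0) (hc : -d⁻¹ ≠ 0) (f : HT K (In n)) :
    Ls K (-d⁻¹) (Φs K d f) = Δs K hd (Ψs K (Δs K hc (Ls K d⁻¹ f))) := by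
  have h : (Φs K (n := n) d).trans (Ls K (-d⁻¹)) = (((Ls K d⁻¹).trans (Δs K hc)).trans (Ψs K)).trans (Δs K hd) :=
    algEquiv_ext_XY K
      (fun a => by
        simp only [AlgEquiv.trans_apply]
        rw [Φs_X, map_add, map_smul, Ls_X, Ls_Y, Ls_X, Δs_X, Ψs_X, Δs_Y, smul_add, smul_smul, mul_neg, mul_inv_cancel₀ hd, neg_smul,
          one_smul]
        abel)
      (fun a => by
        simp only [AlgEquiv.trans_apply]
        rw [Φs_Y, Ls_Y, Ls_Y, map_add, map_smul, Δs_Y, Δs_X, map_add, map_smul, map_smul, Ψs_Y, Ψs_X, map_add, map_smul, map_smul,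
          Δs_X, Δs_Y, smul_smul, inv_mul_cancel₀ hd, one_smul]
        abel)
  exact AlgEquiv.congr_fun h f

/-- **hence on th-7's classes: `Ls (−d⁻¹) (Φs d (w_n(q))) = w_n(scaleSeq d (rev_n (scaleSeq (−d⁻¹) (lowMul d⁻¹ q))))`** — the right side is computed by
`Ls_w`, E12's `Δs_w`, E7's `Ψs_w`; no binomial identity is used. -/
theorem Ls_neg_Φs_w {d : K} (hd : d ≠ 0) (q : ℕ → K) :
    Ls K (-d⁻¹) (Φs K d (w K n n q)) = w K n n (scaleSeq K d (rev K n (scaleSeq K (-d⁻¹) (lowMul K n d⁻¹ q)))) := by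
  have hc : -d⁻¹ ≠ 0 := neg_ne_zero.mpr (inv_ne_zero hd)
  rw [Ls_neg_Φs K hd hc, Ls_w, Δs_w K hc le_rfl, Ψs_w K le_rfl, Δs_w K hd le_rfl]

/-- **THE TOP WINDOW IT PRODUCES**: for `q` supported on `[0, P′]` (`P′ ≤ n`), `s := scaleSeq d (rev_n (scaleSeq (−d⁻¹) (lowMul d⁻¹ q)))` vanishes below
`n − P′` … -/
theorem topWindow_apply_eq_zero {d : K} {P' : ℕ} {q : ℕ → K} (hq : ∀ j, P' < j → q j = 0) {j : ℕ} (hj : j < n - P') :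
    scaleSeq K d (rev K n (scaleSeq K (-d⁻¹) (lowMul K n d⁻¹ q))) j = 0 := by
  rw [scaleSeq, rev_apply_of_le K (show j ≤ n by omega), scaleSeq, lowMul_apply_eq_zero K d⁻¹ hq (show P' < n - j by omega), mul_zero, mul_zero]

/-- … and its entry at `n − P′` is `d^{n−P′} (−d⁻¹)^{P′} q_{P′}`. -/
theorem topWindow_apply_sub {d : K} {P' : ℕ} (hP' : P' ≤ n) {q : ℕ → K} (hq : ∀ j, P' < j → q j = 0) :
    scaleSeq K d (rev K n (scaleSeq K (-d⁻¹) (lowMul K n d⁻¹ q))) (n - P') = d ^ (n - P') * ((-d⁻¹) ^ P' * q P') := by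
  rw [scaleSeq, rev_apply_sub K hP', scaleSeq, lowMul_apply_self K d⁻¹ hP' hq]

/-! ## §47. The two-frame automorphism -/

/-- **THE TWO-FRAME AUTOMORPHISM `Gs λ μ := Φs λ ∘ Ls (μ−λ)⁻¹`** — it carries the frame pair `(x_a, y_a)` to `(u^λ_a, (μ−λ)⁻¹ u^μ_a)`, the nodes `0 ↦ λ`,
`∞ ↦ μ`. -/
noncomputable def Gs (lam mu : K) : HT K (In n) ≃ₐ[K] HT K (In n) := (Ls K (mu - lam)⁻¹).trans (Φs K lam)

/-- `Gs λ μ f = Φs λ (Ls (μ−λ)⁻¹ f)`. -/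
lemma Gs_apply (lam mu : K) (f : HT K (In n)) : Gs K lam mu f = Φs K lam (Ls K (mu - lam)⁻¹ f) := rfl

/-- **`Gs λ μ (x_a) = x_a + λ y_a`** (the frame vector `u^λ_a`). -/
theorem Gs_X (lam mu : K) (a : Fin n) : Gs K (n := n) lam mu (X K n a) = X K n a + lam • Y K n a := by
  rw [Gs_apply, Ls_X, Φs_X]

/-- **`Gs λ μ (y_a) = (μ−λ)⁻¹ (x_a + μ y_a)`** (`∝` the frame vector `u^μ_a`; `λ ≠ μ`). -/
theorem Gs_Y {lam mu : K} (h : lam ≠ mu) (a : Fin n) : Gs K (n := n) lam mu (Y K n a) = (mu - lam)⁻¹ • (X K n a + mu • Y K n a) := by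
  rw [Gs_apply, Ls_Y, map_add, map_smul, Φs_Y, Φs_X, smul_add, smul_add, smul_smul, smul_smul]
  have e : (mu - lam)⁻¹ * mu = 1 + (mu - lam)⁻¹ * lam := by
    have := inv_mul_cancel₀ (sub_ne_zero.mpr (Ne.symm h)); linear_combination this
  rw [e, add_smul, one_smul]; abel

/-- images of submodules under a composite automorphism. -/
lemma map_trans_eq (e₁ e₂ : HT K (In n) ≃ₐ[K] HT K (In n)) (N : Submodule K (HT K (In n))) :
    N.map (e₁.trans e₂).toLinearMap = (N.map e₁.toLinearMap).map e₂.toLinearMap := by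
  have h : (e₁.trans e₂).toLinearMap = e₂.toLinearMap ∘ₗ e₁.toLinearMap := LinearMap.ext fun _ => rfl
  rw [h, Submodule.map_comp]

/-- kernels are transported by the swap (E7's `Kr_mapEquiv`). -/
lemma Kr_Ψs (f : HT K (In n)) (k : ℕ) : Kr K Finset.univ (Ψs K f) k = (Kr K Finset.univ f k).map (Ψs K (n := n)).toLinearMap :=
  Kr_mapEquiv K _ f k

/-- **`Kr(univ, Ls c f, k) = Ls c (Kr(univ, f, k))`.** -/
theorem Kr_Ls (c : K) (f : HT K (In n)) (k : ℕ) : Kr K Finset.univ (Ls K c f) k = (Kr K Finset.univ f k).map (Ls K (n := n) c).toLinearMap := by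
  rw [Ls_apply, Kr_Ψs, Kr_Φs, Kr_Ψs]
  show _ = (Kr K Finset.univ f k).map (((Ψs K (n := n)).trans (Φs K c)).trans (Ψs K)).toLinearMap
  rw [map_trans_eq, map_trans_eq]

/-- **`Kr(univ, Gs λ μ f, k) = Gs λ μ (Kr(univ, f, k))`.** -/
theorem Kr_Gs (lam mu : K) (f : HT K (In n)) (k : ℕ) :
    Kr K Finset.univ (Gs K lam mu f) k = (Kr K Finset.univ f k).map (Gs K (n := n) lam mu).toLinearMap := by
  rw [Gs_apply, Kr_Φs, Kr_Ls]
  show _ = (Kr K Finset.univ f k).map ((Ls K (mu - lam)⁻¹).trans (Φs K lam)).toLinearMap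
  rw [map_trans_eq]

/-- **the lower shear fixes the Siegel ideal.** -/
theorem map_Ls_siegelIdeal (c : K) (k : ℕ) : (siegelIdeal K n k).map (Ls K (n := n) c).toLinearMap = siegelIdeal K n k := by
  show (siegelIdeal K n k).map (((Ψs K (n := n)).trans (Φs K c)).trans (Ψs K)).toLinearMap = _
  rw [map_trans_eq, map_trans_eq, map_Ψs_siegelIdeal, map_Φs_siegelIdeal, map_Ψs_siegelIdeal]

/-- **the two-frame automorphism fixes the Siegel ideal.** -/
theorem map_Gs_siegelIdeal (lam mu : K) (k : ℕ) : (siegelIdeal K n k).map (Gs K (n := n) lam mu).toLinearMap = siegelIdeal K n k := by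
  show (siegelIdeal K n k).map ((Ls K (mu - lam)⁻¹).trans (Φs K lam)).toLinearMap = _
  rw [map_trans_eq, map_Ls_siegelIdeal, map_Φs_siegelIdeal]

/-- `Φs λ ∘ Φs d` acts on classes as `Φs (λ + d)` (E9's one-parameter group). -/
lemma Φs_Φs_w (lam d : K) (q : ℕ → K) : Φs K lam (Φs K d (w K n n q)) = w K n n (expMul K (lam + d) q) := by
  rw [Φs_w K d le_rfl, Φs_w K lam le_rfl]
  exact congrArg _ (funext (expMul_expMul K lam d q))

/-! ## §48. The two-node confluent kernel law at two finite nodes -/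

/-- **THE PREIMAGE CLASS**: for `λ ≠ μ`, `d = μ − λ`, the class `w_n(expMul λ q₁ + expMul μ q₂)` is the `Gs λ μ`-image of `w_n(r₁ + s)` with
`r₁ = lowMul (−d⁻¹) q₁` (a node at `0` of the same order as `q₁`) and `s = scaleSeq d (rev_n (scaleSeq (−d⁻¹) (lowMul d⁻¹ q₂)))` (a top window of the
order of `q₂`). -/
theorem w_expMul_add_expMul_eq_Gs {lam mu : K} (h : lam ≠ mu) (q₁ q₂ : ℕ → K) :
    w K n n (fun j => expMul K lam q₁ j + expMul K mu q₂ j) =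
      Gs K lam mu (w K n n (fun j => lowMul K n (-(mu - lam)⁻¹) q₁ j +
        scaleSeq K (mu - lam) (rev K n (scaleSeq K (-(mu - lam)⁻¹) (lowMul K n (mu - lam)⁻¹ q₂))) j)) := by
  have hd : mu - lam ≠ 0 := sub_ne_zero.mpr (Ne.symm h)
  rw [w_add, w_add, map_add, Gs_apply, Gs_apply, ← Ls_w K (-(mu - lam)⁻¹) q₁, Ls_Ls_neg, Φs_w K lam le_rfl,
    ← Ls_neg_Φs_w K hd q₂, Ls_Ls_neg, Φs_Φs_w, add_sub_cancel]

/-- **THE TWO-NODE CONFLUENT KERNEL LAW AT TWO FINITE NODES**: `λ ≠ μ`, `q₁` supported on `[0, P]` with `q₁ P ≠ 0`, `q₂` supported on `[0, P′]` with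
`q₂ P′ ≠ 0`, `k + P + P′ + 1 ≤ n` ⇒ **`Kr(univ, w_n(expMul λ q₁ + expMul μ q₂), k) = SI_k ⊔ Gs λ μ (xyRich(k, P, P′))`** — the Siegel ideal plus the
`Gs λ μ`-image of «more than `P` x-letters and more than `P′` y-letters», i.e. the forms with more than `P` letters from the frame `{x_a + λ y_a}` and more
than `P′` letters from the frame `{x_a + μ y_a}` (E8 at `(0, ∞)` transported by the two-frame automorphism; the preimage class is `w_expMul_add_expMul_eq_Gs`). -/
theorem Kr_w_two_finite_nodes {lam mu : K} (h : lam ≠ mu) {k P P' : ℕ} (hkP : k + P + P' + 1 ≤ n) {q₁ q₂ : ℕ → K}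
    (hq₁ : ∀ j, P < j → q₁ j = 0) (hq₁P : q₁ P ≠ 0) (hq₂ : ∀ j, P' < j → q₂ j = 0) (hq₂P : q₂ P' ≠ 0) :
    Kr K Finset.univ (w K n n (fun j => expMul K lam q₁ j + expMul K mu q₂ j)) k =
      siegelIdeal K n k ⊔ (xyRich K n k P P').map (Gs K (n := n) lam mu).toLinearMap := by
  have hd : mu - lam ≠ 0 := sub_ne_zero.mpr (Ne.symm h)
  have hc : -(mu - lam)⁻¹ ≠ 0 := neg_ne_zero.mpr (inv_ne_zero hd)
  rw [w_expMul_add_expMul_eq_Gs K h, Kr_Gs, Kr_w_eq_of_two_orders K hkP (P := P) (P' := P'), Submodule.map_sup, map_Gs_siegelIdeal]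
  · intro j hj hj'
    rw [lowMul_apply_eq_zero K _ hq₁ hj, topWindow_apply_eq_zero K hq₂ hj', add_zero]
  · rw [lowMul_apply_self K _ (by omega) hq₁, topWindow_apply_eq_zero K hq₂ (show P < n - P' by omega), add_zero]; exact hq₁P
  · rw [lowMul_apply_eq_zero K _ hq₁ (show P < n - P' by omega), topWindow_apply_sub K (by omega) hq₂, zero_add]
    exact mul_ne_zero (pow_ne_zero _ hd) (mul_ne_zero (pow_ne_zero _ hc) hq₂P)

/-- **THE KERNEL DEPENDS ONLY ON `(λ, μ, P, P′)`.** -/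
theorem Kr_w_two_finite_nodes_eq {lam mu : K} (h : lam ≠ mu) {k P P' : ℕ} (hkP : k + P + P' + 1 ≤ n) {q₁ q₂ q₁' q₂' : ℕ → K}
    (hq₁ : ∀ j, P < j → q₁ j = 0) (hq₁P : q₁ P ≠ 0) (hq₂ : ∀ j, P' < j → q₂ j = 0) (hq₂P : q₂ P' ≠ 0)
    (hq₁' : ∀ j, P < j → q₁' j = 0) (hq₁P' : q₁' P ≠ 0) (hq₂' : ∀ j, P' < j → q₂' j = 0) (hq₂P' : q₂' P' ≠ 0) :
    Kr K Finset.univ (w K n n (fun j => expMul K lam q₁ j + expMul K mu q₂ j)) k =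
      Kr K Finset.univ (w K n n (fun j => expMul K lam q₁' j + expMul K mu q₂' j)) k := by
  rw [Kr_w_two_finite_nodes K h hkP hq₁ hq₁P hq₂ hq₂P, Kr_w_two_finite_nodes K h hkP hq₁' hq₁P' hq₂' hq₂P']

/-- **THE SYMMETRY `λ ↔ μ`**: exchanging the roles of the two nodes exchanges `(P, P′)`: `SI_k ⊔ Gs λ μ (xyRich(k,P,P′)) = SI_k ⊔ Gs μ λ (xyRich(k,P′,P))`. -/
theorem sup_map_Gs_xyRich_comm {lam mu : K} (h : lam ≠ mu) {k P P' : ℕ} (hkP : k + P + P' + 1 ≤ n) :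
    siegelIdeal K n k ⊔ (xyRich K n k P P').map (Gs K (n := n) lam mu).toLinearMap =
      siegelIdeal K n k ⊔ (xyRich K n k P' P).map (Gs K (n := n) mu lam).toLinearMap := by
  have h1 := Kr_w_two_finite_nodes K h hkP (P := P) (P' := P') (q₁ := fun i => if i = P then (1 : K) else 0)
    (q₂ := fun i => if i = P' then (1 : K) else 0) (fun j hj => if_neg (by omega)) (by rw [if_pos rfl]; exact one_ne_zero)
    (fun j hj => if_neg (by omega)) (by rw [if_pos rfl]; exact one_ne_zero)
  have h2 := Kr_w_two_finite_nodes K (Ne.symm h) (show k + P' + P + 1 ≤ n by omega) (P := P') (P' := P)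
    (q₁ := fun i => if i = P' then (1 : K) else 0) (q₂ := fun i => if i = P then (1 : K) else 0)
    (fun j hj => if_neg (by omega)) (by rw [if_pos rfl]; exact one_ne_zero) (fun j hj => if_neg (by omega)) (by rw [if_pos rfl]; exact one_ne_zero)
  have e : (fun j => expMul K lam (fun i => if i = P then (1 : K) else 0) j + expMul K mu (fun i => if i = P' then (1 : K) else 0) j) =
      fun j => expMul K mu (fun i => if i = P' then (1 : K) else 0) j + expMul K lam (fun i => if i = P then (1 : K) else 0) j :=
    funext fun j => add_comm _ _
  rw [← h1, e, h2]

/-- **TWO PURE CLASSES `A λ^• + B μ^•`** (`A, B ≠ 0`, `λ ≠ μ`, `k + 1 ≤ n`): **`Kr = Gs λ μ (xyRich(k, 0, 0))` EXACTLY** — the forms with a letter from each of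
the two frames (gen 14's `F_λ(k) ∩ F_μ(k)`, there from the rank of a secant; here with the orders `(0,0)` of the two-node law). -/
theorem Kr_w_exp_add_exp {lam mu : K} (h : lam ≠ mu) {k : ℕ} (hk : k + 1 ≤ n) {A B : K} (hA : A ≠ 0) (hB : B ≠ 0) :
    Kr K Finset.univ (w K n n (fun j => A * lam ^ j + B * mu ^ j)) k = (xyRich K n k 0 0).map (Gs K (n := n) lam mu).toLinearMap := by
  have e : (fun j => A * lam ^ j + B * mu ^ j) =
      fun j => expMul K lam (fun i => if i = 0 then A else 0) j + expMul K mu (fun i => if i = 0 then B else 0) j := by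
    funext j; rw [expMul_spike_zero, expMul_spike_zero]
  rw [e, Kr_w_two_finite_nodes K h (P := 0) (P' := 0) (by omega) (fun j hj => if_neg (by omega)) (by rwa [if_pos rfl])
      (fun j hj => if_neg (by omega)) (by rwa [if_pos rfl]), sup_eq_right]
  calc siegelIdeal K n k = (siegelIdeal K n k).map (Gs K (n := n) lam mu).toLinearMap := (map_Gs_siegelIdeal K lam mu k).symm
    _ ≤ (xyRich K n k 0 0).map (Gs K (n := n) lam mu).toLinearMap := Submodule.map_mono (siegelIdeal_le_xyRich_zero K k)

/-! ## §49. The Hankel rank of a class with two finite nodes -/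

/-- **`dim Kr(univ, w_n(expMul λ q₁ + expMul μ q₂), k) + min(k+1, P+P′+2)·C(n,k) = C(2n,k)`** (the kernel is the `Gs`-image of E8's; E10's count). -/
theorem finrank_Kr_w_two_finite_nodes {lam mu : K} (h : lam ≠ mu) {k P P' : ℕ} (hkP : k + P + P' + 1 ≤ n) {q₁ q₂ : ℕ → K}
    (hq₁ : ∀ j, P < j → q₁ j = 0) (hq₁P : q₁ P ≠ 0) (hq₂ : ∀ j, P' < j → q₂ j = 0) (hq₂P : q₂ P' ≠ 0) :
    finrank K (Kr K Finset.univ (w K n n (fun j => expMul K lam q₁ j + expMul K mu q₂ j)) k) + min (k + 1) (P + P' + 2) * n.choose k =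
      (n + n).choose k := by
  have hd : mu - lam ≠ 0 := sub_ne_zero.mpr (Ne.symm h)
  have hc : -(mu - lam)⁻¹ ≠ 0 := neg_ne_zero.mpr (inv_ne_zero hd)
  rw [w_expMul_add_expMul_eq_Gs K h, Kr_Gs, (Gs K (n := n) lam mu).toLinearEquiv.finrank_map_eq]
  refine finrank_Kr_w_of_two_orders K hkP (P := P) (P' := P') ?_ ?_ ?_
  · intro j hj hj'
    rw [lowMul_apply_eq_zero K _ hq₁ hj, topWindow_apply_eq_zero K hq₂ hj', add_zero]
  · rw [lowMul_apply_self K _ (by omega) hq₁, topWindow_apply_eq_zero K hq₂ (show P < n - P' by omega), add_zero]; exact hq₁P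
  · rw [lowMul_apply_eq_zero K _ hq₁ (show P < n - P' by omega), topWindow_apply_sub K (by omega) hq₂, zero_add]
    exact mul_ne_zero (pow_ne_zero _ hd) (mul_ne_zero (pow_ne_zero _ hc) hq₂P)

/-- **THE TWO-FINITE-NODE RANK LAW: `rank H_k(expMul λ q₁ + expMul μ q₂) = min(k+1, P+P′+2)`** (`λ ≠ μ`, orders `P+1`, `P′+1`, `k + P + P′ + 1 ≤ n`) — each
node contributes its order to the catalecticant rank, up to the number of rows (THEOREM H; no matrix computation, no confluent Vandermonde determinant). -/
theorem rank_hankel1_two_finite_nodes {lam mu : K} (h : lam ≠ mu) {k P P' : ℕ} (hkP : k + P + P' + 1 ≤ n) {q₁ q₂ : ℕ → K}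
    (hq₁ : ∀ j, P < j → q₁ j = 0) (hq₁P : q₁ P ≠ 0) (hq₂ : ∀ j, P' < j → q₂ j = 0) (hq₂P : q₂ P' ≠ 0) :
    (hankel1 K n k (fun j => expMul K lam q₁ j + expMul K mu q₂ j)).rank = min (k + 1) (P + P' + 2) := by
  have h1 := finrank_Kr_w_add_rank K (n := n) k (fun j => expMul K lam q₁ j + expMul K mu q₂ j)
  have h2 := finrank_Kr_w_two_finite_nodes K h hkP hq₁ hq₁P hq₂ hq₂P
  have hpos : 0 < n.choose k := Nat.choose_pos (by omega)
  have h3 : n.choose k * (hankel1 K n k (fun j => expMul K lam q₁ j + expMul K mu q₂ j)).rank = n.choose k * min (k + 1) (P + P' + 2) := by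
    rw [mul_comm (n.choose k) (min (k + 1) (P + P' + 2))]; omega
  exact Nat.eq_of_mul_eq_mul_left hpos h3

/-- **TWO EXPONENTIALS: `rank H_k(A λ^• + B μ^•) = min(k+1, 2)`** (`A, B ≠ 0`, `λ ≠ μ`, `k + 1 ≤ n`) — gen 14's secant value `r = 2`, here from the two-node law. -/
theorem rank_hankel1_exp_add_exp {lam mu : K} (h : lam ≠ mu) {k : ℕ} (hk : k + 1 ≤ n) {A B : K} (hA : A ≠ 0) (hB : B ≠ 0) :
    (hankel1 K n k (fun j => A * lam ^ j + B * mu ^ j)).rank = min (k + 1) 2 := by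
  have e : (fun j => A * lam ^ j + B * mu ^ j) =
      fun j => expMul K lam (fun i => if i = 0 then A else 0) j + expMul K mu (fun i => if i = 0 then B else 0) j := by
    funext j; rw [expMul_spike_zero, expMul_spike_zero]
  rw [e]
  exact rank_hankel1_two_finite_nodes K h (P := 0) (P' := 0) (by omega) (fun j hj => if_neg (by omega)) (by rwa [if_pos rfl])
    (fun j hj => if_neg (by omega)) (by rwa [if_pos rfl])

end Summit.Ventures.HSemireg.Wedge.HankelFrameChange
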